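import Summits.ABC.ABC.Theorems.DeepRegimeABC.Negative.WithoutEps
import Literature.Barriers.ABC.ExplicitABCQualityFloor
import Literature.NumberTheory.DiophantineGeometry.AbcImpliesHall

/-!
# `DeepRegimeABC` (stmt-ABC-15121): explicit floors for the constant-free depth threshold

Negative-side support lemmas (small-model refutations of explicit strengthenings) for the crux
`Summit.ABC.ABC.Theses.IneffectiveSubspace.DeepRegimeABC`, from the crux disprover's work file
`Cruxes/DeepRegimeABC/Disproof.lean` §(c) (2026-08-16).

The crux is equivalent to its constant-free form `∀ ε > 0 ∃ K, ConstFreeCell(K, ε)` where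
`ConstFreeCell(K, ε)` := "`c < rad(abc)^(1+ε)` for every abc triple with `ω₅(abc) ≥ K`"
(`deepRegimeABC_iff_constFree` in `Theorems/IneffectiveSubspaceDeepRegimeABCNormalForms.lean`; stated
inline below).  Write `K₁(ε)` for the least admissible `K`.  Each record abc triple of depth count
`ω₅ = K₀` and quality `q` REFUTES `ConstFreeCell(K, ε)` for all `K ≤ K₀` and `ε ≤ q − 1`
(`not_constFreeCell_of_witness`, kernel integer arithmetic for the quality comparison):

| triple | `ω₅` (deep primes) | quality | floor |
|---|---|---|---|
| Reyssat `2 + 3¹⁰·109 = 23⁵` | 2 (`3, 23`) | `1.62991…` | `K₁(ε) ≥ 3` for `ε ≤ 0.6299` |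
| Browkin–Brzeziński `19·1307 + 7·29²·31⁸ = 2⁸·3²²·5⁴` | 3 (`2, 3, 31`) | `1.62349…` | `K₁(ε) ≥ 4` for `ε ≤ 0.6234` |
| Nitaj `3¹⁸·23·2269 + 17³·29·31⁸ = 2¹⁰·5²·7¹⁵` | 4 (`2, 3, 7, 31`) | `1.52216…` | `K₁(ε) ≥ 5` for `ε ≤ 0.5221` |

(`constFree_threshold_ge_five`.)  For comparison: quality-preserving breeding reaches only the cells
`K < log₅(1/ε) < 1` at these `ε`; the Robert–Stewart–Tenenbaum heuristic puts `K(ε) ≍ ε⁻²/log²(1/ε)`.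
Below `c ≤ 10⁷` (complete census, Cruxes/DeepRegimeABC/Census-omega-r1-k1.md) the cell `ω₅ = 4` holds
8 hits (record quality `1.3449`) and no hit has `ω₅ ≥ 5`.
-/

-- `Summit.<Summit>.<Problem>` is the mandated summit-side namespace (CONVENTIONS §2); for the
-- single-conjunct summit `ABC` the two coincide, so the duplicate `ABC.ABC` is deliberate.
set_option linter.dupNamespace false

namespace Summit.ABC.ABC.Theorems.DeepRegimeABC.Negative

open Literature.NumberTheory.DiophantineGeometry UniqueFactorizationMonoid

/-- **Generic floor extraction.** An abc triple `(a,b,c)` with `ω₅(abc) ≥ K`, `rad(abc) ≤ R`, `2 ≤ R`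
and `R^P < c^Q` (`0 < Q`) refutes the constant-free cell statement `ConstFreeCell(K, ε)` for every
`ε ≤ P/Q − 1`. [folklore] -/
theorem not_constFreeCell_of_witness {a b c K R P Q : ℕ} (habc : IsABCTriple a b c)
    (hK : K ≤ ((a * b * c).primeFactors.filter (fun p => 5 ≤ (a * b * c).factorization p)).card)
    (hR : rad a b c ≤ R) (hR2 : 2 ≤ R) (hQ : 0 < Q) (hpow : R ^ P < c ^ Q) {ε : ℝ}
    (hε : ε ≤ (P : ℝ) / Q - 1) :
    ¬ ∀ a b c : ℕ, IsABCTriple a b c →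
        K ≤ ((a * b * c).primeFactors.filter (fun p => 5 ≤ (a * b * c).factorization p)).card →
        (c : ℝ) < ((rad a b c : ℕ) : ℝ) ^ (1 + ε) := by
  intro h
  have hlt := h a b c habc hK
  -- c < rad^(1+ε) ≤ R^(1+ε) ≤ R^(P/Q), hence c^Q < R^P: contradiction with hpow
  have hradR : ((rad a b c : ℕ) : ℝ) ≤ R := by exact_mod_cast hR
  have hrad0 : (0 : ℝ) ≤ ((rad a b c : ℕ) : ℝ) := Nat.cast_nonneg _
  have hR1 : (1 : ℝ) ≤ (R : ℝ) := by exact_mod_cast (by omega : 1 ≤ R)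
  have hQR : (0 : ℝ) < Q := by exact_mod_cast hQ
  have hε1 : 0 ≤ 1 + ε := by
    -- if `1 + ε < 0` then `rad^(1+ε) ≤ 1 ≤ c`, contradicting `hlt`
    by_contra hneg
    have hneg : 1 + ε < 0 := not_le.mp hneg
    have hc1 : (1 : ℝ) ≤ c := by
      obtain ⟨ha, hb, hsum, -⟩ := habc
      exact_mod_cast (show 1 ≤ c by omega)
    have hrad1 : (1 : ℝ) ≤ ((rad a b c : ℕ) : ℝ) := by
      rw [rad_def]; exact_mod_cast Nat.radical_pos _
    have : ((rad a b c : ℕ) : ℝ) ^ (1 + ε) ≤ 1 :=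
      Real.rpow_le_one_of_one_le_of_nonpos hrad1 hneg.le
    linarith
  have h1 : (c : ℝ) < (R : ℝ) ^ ((P : ℝ) / Q) :=
    calc (c : ℝ) < ((rad a b c : ℕ) : ℝ) ^ (1 + ε) := hlt
      _ ≤ (R : ℝ) ^ (1 + ε) := Real.rpow_le_rpow hrad0 hradR hε1
      _ ≤ (R : ℝ) ^ ((P : ℝ) / Q) := Real.rpow_le_rpow_of_exponent_le hR1 (by linarith)
  have hc0 : (0 : ℝ) ≤ c := Nat.cast_nonneg _
  have h2 : (c : ℝ) ^ (Q : ℝ) < ((R : ℝ) ^ ((P : ℝ) / Q)) ^ (Q : ℝ) :=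
    Real.rpow_lt_rpow hc0 h1 hQR
  rw [← Real.rpow_mul (by linarith), div_mul_cancel₀ _ hQR.ne', Real.rpow_natCast,
    Real.rpow_natCast] at h2
  have h3 : (R : ℝ) ^ P < (c : ℝ) ^ Q := by exact_mod_cast hpow
  linarith

/-- Cells are nested: `ConstFreeCell(K', ε)` gives `ConstFreeCell(K, ε)` for `K' ≤ K`. [folklore] -/
theorem constFreeCell_mono {K K' : ℕ} {ε : ℝ} (hK : K' ≤ K)
    (h : ∀ a b c : ℕ, IsABCTriple a b c →
        K' ≤ ((a * b * c).primeFactors.filter (fun p => 5 ≤ (a * b * c).factorization p)).card →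
        (c : ℝ) < ((rad a b c : ℕ) : ℝ) ^ (1 + ε)) :
    ∀ a b c : ℕ, IsABCTriple a b c →
        K ≤ ((a * b * c).primeFactors.filter (fun p => 5 ≤ (a * b * c).factorization p)).card →
        (c : ℝ) < ((rad a b c : ℕ) : ℝ) ^ (1 + ε) :=
  fun a b c habc hKle => h a b c habc (hK.trans hKle)

/-! ### Reyssat: `2 + 3¹⁰·109 = 23⁵`, `ω₅ = 2` (`3, 23`), quality `1.62991…` -/

/-- Reyssat's triple has depth count `ω₅ ≥ 2` (`3¹⁰`, `23⁵`). [cite: BombieriGubler2006, Ex. 12.4.14] -/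
theorem two_le_depth_reyssat :
    2 ≤ ((2 * (3 ^ 10 * 109) * 23 ^ 5).primeFactors.filter
      (fun p => 5 ≤ (2 * (3 ^ 10 * 109) * 23 ^ 5).factorization p)).card := by
  have hne : 2 * (3 ^ 10 * 109) * 23 ^ 5 ≠ 0 := by norm_num
  have h3 := mem_deep_of_pow_dvd hne (by norm_num : Nat.Prime 3) (by norm_num)
  have h23 := mem_deep_of_pow_dvd hne (by norm_num : Nat.Prime 23) (by norm_num)
  calc 2 = ({3, 23} : Finset ℕ).card := by rfl
    _ ≤ _ := Finset.card_le_card (by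
      intro p hp
      simp only [Finset.mem_insert, Finset.mem_singleton] at hp
      rcases hp with rfl | rfl <;> assumption)

/-- **`K₁(ε) ≥ 3` for `ε ≤ 0.6299`**: Reyssat's triple (cell `ω₅ ≥ 2`, quality `> 1.6299`) refutes the
constant-free statement on the cell `{ω₅ ≥ 2}`. [cite: BombieriGubler2006, Ex. 12.4.14] -/
theorem not_constFreeCell_two {ε : ℝ} (hε : ε ≤ 0.6299) :
    ¬ ∀ a b c : ℕ, IsABCTriple a b c →
        2 ≤ ((a * b * c).primeFactors.filter (fun p => 5 ≤ (a * b * c).factorization p)).card →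
        (c : ℝ) < ((rad a b c : ℕ) : ℝ) ^ (1 + ε) := by
  refine not_constFreeCell_of_witness (R := 15042) (P := 16299) (Q := 10000)
    Literature.Barriers.ABC.reyssat_isABCTriple two_le_depth_reyssat
    (le_of_eq Literature.Barriers.ABC.rad_reyssat) (by norm_num) (by norm_num)
    Literature.Barriers.ABC.reyssat_pow_lt ?_
  norm_num at hε ⊢; linarith

/-! ### Browkin–Brzeziński: `19·1307 + 7·29²·31⁸ = 2⁸·3²²·5⁴`, `ω₅ = 3` (`2, 3, 31`), quality `1.62349…` -/

/-- The Browkin–Brzeziński triple `19·1307 + 7·29²·31⁸ = 2⁸·3²²·5⁴` is an abc triple.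
[cite: Nitaj1996, §2 (table of good abc examples)] -/
theorem browkinBrzezinski_isABCTriple :
    IsABCTriple (19 * 1307) (7 * 29 ^ 2 * 31 ^ 8) (2 ^ 8 * 3 ^ 22 * 5 ^ 4) := by
  refine ⟨by norm_num, by norm_num, by norm_num, ?_⟩
  norm_num [Nat.coprime_iff_gcd_eq_one]

/-- Its radical is at most `2·3·5·7·19·29·31·1307 = 4688222070` (`abc ∣ 4688222070²²`). [folklore] -/
theorem rad_browkinBrzezinski_le :
    rad (19 * 1307) (7 * 29 ^ 2 * 31 ^ 8) (2 ^ 8 * 3 ^ 22 * 5 ^ 4) ≤ 4688222070 := by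
  rw [rad_def]
  exact radical_le_of_dvd_pow (n := 22) (by norm_num) (by norm_num)

/-- Its depth count is `ω₅ ≥ 3` (`31⁸`, `2⁸`, `3²²`; `5⁴` is not deep). [folklore] -/
theorem three_le_depth_browkinBrzezinski :
    3 ≤ ((19 * 1307 * (7 * 29 ^ 2 * 31 ^ 8) * (2 ^ 8 * 3 ^ 22 * 5 ^ 4)).primeFactors.filter
      (fun p => 5 ≤ (19 * 1307 * (7 * 29 ^ 2 * 31 ^ 8) * (2 ^ 8 * 3 ^ 22 * 5 ^ 4)).factorization
        p)).card := by
  have hne : 19 * 1307 * (7 * 29 ^ 2 * 31 ^ 8) * (2 ^ 8 * 3 ^ 22 * 5 ^ 4) ≠ 0 := by norm_num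
  have h2 := mem_deep_of_pow_dvd hne (by norm_num : Nat.Prime 2) (by norm_num)
  have h3 := mem_deep_of_pow_dvd hne (by norm_num : Nat.Prime 3) (by norm_num)
  have h31 := mem_deep_of_pow_dvd hne (by norm_num : Nat.Prime 31) (by norm_num)
  calc 3 = ({2, 3, 31} : Finset ℕ).card := by rfl
    _ ≤ _ := Finset.card_le_card (by
      intro p hp
      simp only [Finset.mem_insert, Finset.mem_singleton] at hp
      rcases hp with rfl | rfl | rfl <;> assumption)

set_option exponentiation.threshold 20000 in
/-- `4688222070^16234 < (2⁸·3²²·5⁴)^10000`, i.e. quality `> 1.6234` (kernel integer arithmetic).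
[folklore] -/
theorem browkinBrzezinski_pow_lt :
    (4688222070 : ℕ) ^ 16234 < (2 ^ 8 * 3 ^ 22 * 5 ^ 4) ^ 10000 := by
  decide

/-- **`K₁(ε) ≥ 4` for `ε ≤ 0.6234`**: the Browkin–Brzeziński triple (cell `ω₅ ≥ 3`, quality
`> 1.6234`) refutes the constant-free statement on the cell `{ω₅ ≥ 3}`.
[cite: Nitaj1996, §2 (table of good abc examples)] -/
theorem not_constFreeCell_three {ε : ℝ} (hε : ε ≤ 0.6234) :
    ¬ ∀ a b c : ℕ, IsABCTriple a b c →
        3 ≤ ((a * b * c).primeFactors.filter (fun p => 5 ≤ (a * b * c).factorization p)).card →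
        (c : ℝ) < ((rad a b c : ℕ) : ℝ) ^ (1 + ε) := by
  refine not_constFreeCell_of_witness (R := 4688222070) (P := 16234) (Q := 10000)
    browkinBrzezinski_isABCTriple three_le_depth_browkinBrzezinski rad_browkinBrzezinski_le
    (by norm_num) (by norm_num) browkinBrzezinski_pow_lt ?_
  norm_num at hε ⊢; linarith

/-! ### Nitaj: `3¹⁸·23·2269 + 17³·29·31⁸ = 2¹⁰·5²·7¹⁵`, `ω₅ = 4` (`2, 3, 7, 31`), quality `1.52216…` -/

/-- Nitaj's triple `3¹⁸·23·2269 + 17³·29·31⁸ = 2¹⁰·5²·7¹⁵` is an abc triple.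
[cite: Nitaj1996, §2 (table of good abc examples)] -/
theorem nitaj_isABCTriple :
    IsABCTriple (3 ^ 18 * 23 * 2269) (17 ^ 3 * 29 * 31 ^ 8) (2 ^ 10 * 5 ^ 2 * 7 ^ 15) := by
  refine ⟨by norm_num, by norm_num, by norm_num, ?_⟩
  norm_num [Nat.coprime_iff_gcd_eq_one]

/-- Its radical is at most `2·3·5·7·17·23·29·31·2269 = 167490523410` (`abc ∣ 167490523410¹⁸`).
[folklore] -/
theorem rad_nitaj_le :
    rad (3 ^ 18 * 23 * 2269) (17 ^ 3 * 29 * 31 ^ 8) (2 ^ 10 * 5 ^ 2 * 7 ^ 15) ≤ 167490523410 := by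
  rw [rad_def]
  exact radical_le_of_dvd_pow (n := 18) (by norm_num) (by norm_num)

/-- Its depth count is `ω₅ ≥ 4` (`3¹⁸`, `31⁸`, `2¹⁰`, `7¹⁵`). [folklore] -/
theorem four_le_depth_nitaj :
    4 ≤ ((3 ^ 18 * 23 * 2269 * (17 ^ 3 * 29 * 31 ^ 8) * (2 ^ 10 * 5 ^ 2 * 7 ^ 15)).primeFactors.filter
      (fun p => 5 ≤ (3 ^ 18 * 23 * 2269 * (17 ^ 3 * 29 * 31 ^ 8) *
        (2 ^ 10 * 5 ^ 2 * 7 ^ 15)).factorization p)).card := by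
  have hne : 3 ^ 18 * 23 * 2269 * (17 ^ 3 * 29 * 31 ^ 8) * (2 ^ 10 * 5 ^ 2 * 7 ^ 15) ≠ 0 := by
    norm_num
  have h2 := mem_deep_of_pow_dvd hne (by norm_num : Nat.Prime 2) (by norm_num)
  have h3 := mem_deep_of_pow_dvd hne (by norm_num : Nat.Prime 3) (by norm_num)
  have h7 := mem_deep_of_pow_dvd hne (by norm_num : Nat.Prime 7) (by norm_num)
  have h31 := mem_deep_of_pow_dvd hne (by norm_num : Nat.Prime 31) (by norm_num)
  calc 4 = ({2, 3, 7, 31} : Finset ℕ).card := by rfl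
    _ ≤ _ := Finset.card_le_card (by
      intro p hp
      simp only [Finset.mem_insert, Finset.mem_singleton] at hp
      rcases hp with rfl | rfl | rfl | rfl <;> assumption)

set_option exponentiation.threshold 20000 in
/-- `167490523410^15221 < (2¹⁰·5²·7¹⁵)^10000`, i.e. quality `> 1.5221` (kernel integer arithmetic).
[folklore] -/
theorem nitaj_pow_lt : (167490523410 : ℕ) ^ 15221 < (2 ^ 10 * 5 ^ 2 * 7 ^ 15) ^ 10000 := by
  decide

/-- **`K₁(ε) ≥ 5` for `ε ≤ 0.5221`**: Nitaj's triple (cell `ω₅ ≥ 4`, quality `> 1.5221`) refutes the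
constant-free statement on the cell `{ω₅ ≥ 4}`. [cite: Nitaj1996, §2 (table of good abc examples)] -/
theorem not_constFreeCell_four {ε : ℝ} (hε : ε ≤ 0.5221) :
    ¬ ∀ a b c : ℕ, IsABCTriple a b c →
        4 ≤ ((a * b * c).primeFactors.filter (fun p => 5 ≤ (a * b * c).factorization p)).card →
        (c : ℝ) < ((rad a b c : ℕ) : ℝ) ^ (1 + ε) := by
  refine not_constFreeCell_of_witness (R := 167490523410) (P := 15221) (Q := 10000)
    nitaj_isABCTriple four_le_depth_nitaj rad_nitaj_le (by norm_num) (by norm_num) nitaj_pow_lt ?_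
  norm_num at hε ⊢; linarith

/-- **Reading for the crux: every admissible constant-free threshold at `ε ≤ 0.5221` is `≥ 5`.**
If `c < rad(abc)^(1+ε)` holds for all abc triples with `ω₅(abc) ≥ K` and `ε ≤ 0.5221`, then `K ≥ 5`.
[cite: Nitaj1996, §2 (table of good abc examples)] -/
theorem constFree_threshold_ge_five {ε : ℝ} (hε : ε ≤ 0.5221) {K : ℕ}
    (h : ∀ a b c : ℕ, IsABCTriple a b c →
        K ≤ ((a * b * c).primeFactors.filter (fun p => 5 ≤ (a * b * c).factorization p)).card →
        (c : ℝ) < ((rad a b c : ℕ) : ℝ) ^ (1 + ε)) :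
    5 ≤ K := by
  by_contra hK
  exact not_constFreeCell_four hε (constFreeCell_mono (by omega) h)

end Summit.ABC.ABC.Theorems.DeepRegimeABC.Negative
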